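import Mathlib
import HarnessLib
import Summits.AtomisticToContinuum.FouriersLaw.Theses.ResistanceOnset

/-!
# Birth skeleton (BC3) for crux `ResistanceOnset.BridgeClosure`
(item `stmt-AtomisticToContinuum-13488`, route `route-AtomisticToContinuum-ResistanceOnset`, crux rank 5;
sub-problem `FouriersLaw`; registrar `planner-skel-stmt-AtomisticToContinuum-13488-0`, 2026-08-17)

Crux (FIXED, concluded BY NAME below).  Write `FL(T)` for the pointwise Fourier law of
`pinnedChain ω₂ lam β γ` at temperature `T` (the verbatim block of the item: `∃ k > 0` such that along
every weak-steady-state family the finite-`N` responses `D_N(T) = lim_{δ→0,δ≠0} totalCurrent/δ` exist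
and `D_N(T) → k`).  `BridgeClosure`: for all `ω₂ lam β γ > 0`,
`(∃ T₀ > 0, ∀ T ∈ (0,T₀), FL T) → (∃ T₁, ∀ T > T₁, FL T) → ∀ T > 0, FL T`
— Fourier's law on an initial temperature interval and on a tail forces it at every temperature.

## Line `birth` — CONTINUITY METHOD IN TEMPERATURE (open × no-lowest-breakdown, swept upward)

The set of Fourier temperatures `F = {T > 0 | FL T}` is attacked as in a continuity / connectedness
argument on the ray `(0,∞)` (by the PROVED conjugacy `D_N(T; lam, β) = D_N(1; lam·T, β·T)`,
`Literature.Barriers.AtomisticToContinuum.LowTemperatureWeakAnharmonicity`, temperature IS the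
effective anharmonic coupling, so this is a continuity method along the coupling ray):

* `stub_localStability` (F is OPEN — local stability of normal conduction): if `FL T` at some `T > 0`
  then `FL T'` for all `T'` in a neighbourhood `(T−ε, T+ε) ∩ (0,∞)`.  Perturbation theory AROUND A
  DIFFUSIVE POINT (the anharmonic chain at a Fourier temperature), not around the integrable harmonic
  corner: a relative `O(ε/T)` change of both quartic couplings.  Owner mechanism named in the item:
  card complete-analyticity-vitali-propagation (N-uniform analyticity of `D_N` in the couplings +
  Vitali), or a Bricmont–Kupiainen-type expansion around a conducting reference.  Size L / open.
* `stub_noLowestBreakdown` (NO LOWEST BREAKDOWN TEMPERATURE — closedness of F under approach along a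
  full segment from below, given a Fourier tail): if `FL` holds at every `T ∈ (0,a)` and on some tail
  `(T₁,∞)`, then `FL a`.  Owner mechanism named in the item: card
  countable-temperatures-suffice-equicontinuity (N-uniform local equicontinuity of `T ↦ D_N(T)` +
  two-sided a-priori bounds `0 < c ≤ D_N ≤ C` near `a`, so that `κ(T)` neither blows up nor vanishes as
  `T ↑ a`); the tail antecedent is where `HighTFourier` enters (interpolation / convexity mechanisms in
  `T` use both sides).  Size L / open.
* COMPOSITION (sorry-free, real proof) `bridgeClosure_of_localStability_of_noLowestBreakdown :
  stub₁-statement → stub₂-statement → (the crux's definiens verbatim)`, and at the crux's NAME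
  `BridgeClosure_of : ResistanceOnset.BridgeClosure := bridgeClosure_of_… stub_localStability
  stub_noLowestBreakdown` (the only theorem concluding the crux; its `sorry`s are exactly the two stubs).
  The seam is the pure-order SWEEP LEMMA `sweep_Ioi` — if a
  predicate on `(0,∞)` holds on an initial segment, is locally stable, and holds at `a` whenever it holds
  on `(0,a)`, then it holds on all of `(0,∞)` (the set of good initial segments is unbounded: at
  `a = sSup` it would hold on `(0,a)`, hence at `a`, hence beyond `a`) — applied with
  `P T := FL T`, the crux's low-temperature hypothesis as the initial segment and its tail hypothesis
  fed to `stub_noLowestBreakdown`.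

Why the cut is not a costume: `stub_localStability` alone is consistent with
`F = (0,T₀) ∪ (T₁,∞)` (open, both hypotheses of the crux true, conclusion false);
`stub_noLowestBreakdown` alone is consistent with `F = (0,T₀] ∪ (T₁,∞)`; neither is the single-hypothesis
drop (downward closure = `PorousMediumCorner.LowTClosure` stmt-9793 / upward closure) that the refuter's
Checks.lean (`bridge_of_downwardClosure`, `bridge_of_upwardClosure`) records as "open & stronger":
each stub concludes `FL` only locally (a neighbourhood of ONE Fourier temperature / ONE boundary point of
a full Fourier segment), and only the sweep combines them.  BC3 probes `stub → BridgeClosure`,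
`stub → FouriersLaw` by `first | exact? | simpa [S] | (unfold S; simpa) | aesop` FAIL for both stubs
(planner folder `bc/`, quoted in `Lines/birth.md`).
Disproof used: none on file (`ledger crux ls stmt-AtomisticToContinuum-13488`: no workfiles, 2026-08-17).
Refuter evidence respected: Checks.lean (rattack-13488: `bridgeClosure_iff` read-back with `FL p T`,
`not_FL_of_neg` — hence the `0 < T'` binder in `stub_localStability`; single-hypothesis drops avoided).
-/

namespace Summit.AtomisticToContinuum.FouriersLaw.Cruxes.BridgeClosure

namespace Birth

/-! ## The two registered stubs -/

/-- **stub 1 — `stub_localStability` (the set of Fourier temperatures is open in `(0,∞)`).**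
For `pinnedChain ω₂ lam β γ` (all `> 0`) and every `T > 0`: if Fourier's law holds pointwise at `T`
(`FL T`), then there is `ε > 0` such that it holds pointwise at every `T' ∈ (T−ε, T+ε)` with `T' > 0`.
Local stability of normal heat conduction under a small change of temperature = (proved conjugacy) a
small relative change of the two quartic couplings, around a DIFFUSIVE reference point. -/
theorem stub_localStability :
    ∀ ω₂ lam β γ : ℝ, 0 < ω₂ → 0 < lam → 0 < β → 0 < γ → ∀ T : ℝ, 0 < T → (∃ k : ℝ, 0 < k ∧ ∀ μ : (N : ℕ) → ℝ → ℝ → MeasureTheory.Measure (Literature.MathematicalPhysics.KineticTheory.HeatConduction.PhaseSpace N), (∀ (N : ℕ) (T_L T_R : ℝ), 0 < T_L → 0 < T_R → (Literature.MathematicalPhysics.KineticTheory.HeatConduction.pinnedChain ω₂ lam β γ).IsSteadyState N T_L T_R (μ N T_L T_R)) → ∃ D : ℕ → ℝ, (∀ N : ℕ, Filter.Tendsto (fun δ : ℝ => (Literature.MathematicalPhysics.KineticTheory.HeatConduction.pinnedChain ω₂ lam β γ).totalCurrent (μ N (T + δ / 2) (T - δ / 2)) / δ) (nhdsWithin 0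 {(0 : ℝ)}ᶜ) (nhds (D N))) ∧ Filter.Tendsto D Filter.atTop (nhds k)) → ∃ ε : ℝ, 0 < ε ∧ ∀ T' : ℝ, 0 < T' → T - ε < T' → T' < T + ε → ∃ k : ℝ, 0 < k ∧ ∀ μ : (N : ℕ) → ℝ → ℝ → MeasureTheory.Measure (Literature.MathematicalPhysics.KineticTheory.HeatConduction.PhaseSpace N), (∀ (N : ℕ) (T_L T_R : ℝ), 0 < T_L → 0 < T_R → (Literature.MathematicalPhysics.KineticTheory.HeatConduction.pinnedChain ω₂ lam β γ).IsSteadyState N T_L T_R (μ N T_L T_R)) → ∃ D : ℕ → ℝ, (∀ N : ℕ, Filter.Tendsto (fun δ : ℝ => (Literature.MathematicalPhysics.KineticTheory.HeatConduction.pinnedChain ω₂ lam β γ).totalCurrent (μ N (T' + δ / 2) (T' - δ / 2)) / δ) (nhdsWithin 0 {(0 : ℝ)}ᶜ) (nhds (D N))) ∧ Filter.Tendsto D Filter.atTop (nhds k) := by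
  sorry

/-- **stub 2 — `stub_noLowestBreakdown` (no lowest breakdown temperature, given a Fourier tail).**
For `pinnedChain ω₂ lam β γ` (all `> 0`): if Fourier's law holds pointwise on some tail `(T₁,∞)`, then
for every `a > 0` such that it holds pointwise at every `T ∈ (0,a)`, it holds pointwise at `a`
(`FL a`): the limit conductivity neither blows up nor vanishes, and `D_N(a)` still converges, when `a`
is approached along a full segment of Fourier temperatures. -/
theorem stub_noLowestBreakdown :
    ∀ ω₂ lam β γ : ℝ, 0 < ω₂ → 0 < lam → 0 < β → 0 < γ → (∃ T₁ : ℝ, ∀ T : ℝ, T₁ < T → ∃ k : ℝ, 0 < k ∧ ∀ μ : (N : ℕ) → ℝ → ℝ → MeasureTheory.Measure (Literature.MathematicalPhysics.KineticTheory.HeatConduction.PhaseSpace N), (∀ (N : ℕ) (T_L T_R : ℝ), 0 < T_L → 0 < T_R → (Literature.MathematicalPhysics.KineticTheory.HeatConduction.pinnedChain ω₂ lam β γ).IsSteadyState N T_L T_R (μ N T_L T_R)) → ∃ D : ℕ → ℝ, (∀ N : ℕ, Filter.Tendsto (fun δ : ℝ => (Literature.MathematicalPhysics.KineticTheory.HeatConduction.pinnedChain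 ω₂ lam β γ).totalCurrent (μ N (T + δ / 2) (T - δ / 2)) / δ) (nhdsWithin 0 {(0 : ℝ)}ᶜ) (nhds (D N))) ∧ Filter.Tendsto D Filter.atTop (nhds k)) → ∀ a : ℝ, 0 < a → (∀ T : ℝ, 0 < T → T < a → ∃ k : ℝ, 0 < k ∧ ∀ μ : (N : ℕ) → ℝ → ℝ → MeasureTheory.Measure (Literature.MathematicalPhysics.KineticTheory.HeatConduction.PhaseSpace N), (∀ (N : ℕ) (T_L T_R : ℝ), 0 < T_L → 0 < T_R → (Literature.MathematicalPhysics.KineticTheory.HeatConduction.pinnedChain ω₂ lam β γ).IsSteadyState N T_L T_R (μ N T_L T_R)) → ∃ D : ℕ → ℝ, (∀ N : ℕ, Filter.Tendsto (fun δ : ℝ => (Literature.MathematicalPhysics.KineticTheory.HeatConduction.pinnedChain ω₂ lam β γ).totalCurrent (μ N (T + δ / 2) (T - δ / 2)) / δ) (nhdsWithin 0 {(0 : ℝ)}ᶜ) (nhds (D N))) ∧ Filter.Tendsto D Filter.atTop (nhds k)) → ∃ k : ℝ, 0 < k ∧ ∀ μ : (N : ℕ) → ℝ → ℝ → MeasureTheory.Measure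 (Literature.MathematicalPhysics.KineticTheory.HeatConduction.PhaseSpace N), (∀ (N : ℕ) (T_L T_R : ℝ), 0 < T_L → 0 < T_R → (Literature.MathematicalPhysics.KineticTheory.HeatConduction.pinnedChain ω₂ lam β γ).IsSteadyState N T_L T_R (μ N T_L T_R)) → ∃ D : ℕ → ℝ, (∀ N : ℕ, Filter.Tendsto (fun δ : ℝ => (Literature.MathematicalPhysics.KineticTheory.HeatConduction.pinnedChain ω₂ lam β γ).totalCurrent (μ N (a + δ / 2) (a - δ / 2)) / δ) (nhdsWithin 0 {(0 : ℝ)}ᶜ) (nhds (D N))) ∧ Filter.Tendsto D Filter.atTop (nhds k) := by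
  sorry

/-! ## The sweep lemma (pure order theory on `ℝ`, sorry-free) -/

/-- **Upward sweep on `(0,∞)`.**  If `P` holds on an initial segment `(0,T₀)`, is locally stable
(`P T ⇒ P` on a neighbourhood of `T` in `(0,∞)`), and holds at `a > 0` whenever it holds on all of
`(0,a)`, then `P` holds at every `T > 0`.  Proof: the set `S` of endpoints `t` with `P` on `(0,t)` is
not bounded above — otherwise `a := sSup S` satisfies `P` on `(0,a)`, hence `P a`, hence `P` on
`(0,a+ε)`, i.e. `a + ε ∈ S`, contradicting `a = sSup S`. -/
theorem sweep_Ioi {P : ℝ → Prop}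
    (hopen : ∀ T : ℝ, 0 < T → P T → ∃ ε : ℝ, 0 < ε ∧ ∀ T' : ℝ, 0 < T' → T - ε < T' → T' < T + ε → P T')
    (hclosed : ∀ a : ℝ, 0 < a → (∀ T : ℝ, 0 < T → T < a → P T) → P a)
    (h0 : ∃ T₀ : ℝ, 0 < T₀ ∧ ∀ T : ℝ, 0 < T → T < T₀ → P T) :
    ∀ T : ℝ, 0 < T → P T := by
  obtain ⟨T₀, hT₀, hinit⟩ := h0
  -- `S` = the endpoints of initial segments on which `P` holds
  have hT₀S : T₀ ∈ {t : ℝ | ∀ T : ℝ, 0 < T → T < t → P T} := hinit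
  have hne : ({t : ℝ | ∀ T : ℝ, 0 < T → T < t → P T} : Set ℝ).Nonempty := ⟨T₀, hT₀S⟩
  have hnb : ¬ BddAbove {t : ℝ | ∀ T : ℝ, 0 < T → T < t → P T} := by
    intro hb
    have hT₀a : T₀ ≤ sSup {t : ℝ | ∀ T : ℝ, 0 < T → T < t → P T} := le_csSup hb hT₀S
    have ha0 : 0 < sSup {t : ℝ | ∀ T : ℝ, 0 < T → T < t → P T} := lt_of_lt_of_le hT₀ hT₀a
    -- `P` holds on `(0, sSup S)`
    have haS : ∀ T : ℝ, 0 < T → T < sSup {t : ℝ | ∀ T : ℝ, 0 < T → T < t → P T} → P T := by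
      intro T hT hTa
      obtain ⟨t, htS, hTt⟩ := exists_lt_of_lt_csSup hne hTa
      exact htS T hT hTt
    -- hence at `sSup S`, hence on a neighbourhood of it
    have hPa : P (sSup {t : ℝ | ∀ T : ℝ, 0 < T → T < t → P T}) := hclosed _ ha0 haS
    obtain ⟨ε, hε, hball⟩ := hopen _ ha0 hPa
    have hmem : sSup {t : ℝ | ∀ T : ℝ, 0 < T → T < t → P T} + ε ∈
        {t : ℝ | ∀ T : ℝ, 0 < T → T < t → P T} := by
      intro T hT hTlt
      rcases lt_trichotomy T (sSup {t : ℝ | ∀ T : ℝ, 0 < T → T < t → P T}) with h | h | h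
      · exact haS T hT h
      · rw [h]
        exact hPa
      · exact hball T hT (by linarith) hTlt
    have hle : sSup {t : ℝ | ∀ T : ℝ, 0 < T → T < t → P T} + ε ≤
        sSup {t : ℝ | ∀ T : ℝ, 0 < T → T < t → P T} := le_csSup hb hmem
    linarith
  intro T hT
  obtain ⟨t, htS, hTt⟩ := not_bddAbove_iff.1 hnb T
  exact htS T hT hTt

/-! ## The composition (sorry-free) -/

/-- **The implication, sorry-free** (axioms `propext`, `Classical.choice`, `Quot.sound`):
`stub_localStability`-statement → `stub_noLowestBreakdown`-statement → the statement of
`ResistanceOnset.BridgeClosure` (conclusion = the crux's definiens VERBATIM — definitionally the route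
decl — so that `BridgeClosure_of` below is this term at the crux's name and is the ONLY theorem of the
file concluding the crux by name).  Proof: the sweep lemma with `P T := FL T`, the crux's
low-temperature hypothesis as the initial segment, the first statement as openness and the second (fed
the crux's tail hypothesis) as closedness from below. -/
theorem bridgeClosure_of_localStability_of_noLowestBreakdown :
    (∀ ω₂ lam β γ : ℝ, 0 < ω₂ → 0 < lam → 0 < β → 0 < γ → ∀ T : ℝ, 0 < T → (∃ k : ℝ, 0 < k ∧ ∀ μ : (N : ℕ) → ℝ → ℝ → MeasureTheory.Measure (Literature.MathematicalPhysics.KineticTheory.HeatConduction.PhaseSpace N), (∀ (N : ℕ) (T_L T_R : ℝ), 0 < T_L → 0 < T_R → (Literature.MathematicalPhysics.KineticTheory.HeatConduction.pinnedChain ω₂ lam β γ).IsSteadyState N T_L T_R (μ N T_L T_R)) → ∃ D : ℕ → ℝ, (∀ N : ℕ, Filter.Tendsto (fun δ : ℝ => (Literature.MathematicalPhysics.KineticTheory.HeatConduction.pinnedChain ω₂ lam β γ).totalCurrent (μ N (T + δ / 2) (T - δ / 2)) / δ) (nhdsWithin 0 {(0 : ℝ)}ᶜ) (nhds (D N)))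 ∧ Filter.Tendsto D Filter.atTop (nhds k)) → ∃ ε : ℝ, 0 < ε ∧ ∀ T' : ℝ, 0 < T' → T - ε < T' → T' < T + ε → ∃ k : ℝ, 0 < k ∧ ∀ μ : (N : ℕ) → ℝ → ℝ → MeasureTheory.Measure (Literature.MathematicalPhysics.KineticTheory.HeatConduction.PhaseSpace N), (∀ (N : ℕ) (T_L T_R : ℝ), 0 < T_L → 0 < T_R → (Literature.MathematicalPhysics.KineticTheory.HeatConduction.pinnedChain ω₂ lam β γ).IsSteadyState N T_L T_R (μ N T_L T_R)) → ∃ D : ℕ → ℝ, (∀ N : ℕ, Filter.Tendsto (fun δ : ℝ => (Literature.MathematicalPhysics.KineticTheory.HeatConduction.pinnedChain ω₂ lam β γ).totalCurrent (μ N (T' + δ / 2) (T' - δ / 2)) / δ) (nhdsWithin 0 {(0 : ℝ)}ᶜ) (nhds (D N))) ∧ Filter.Tendsto D Filter.atTop (nhds k)) →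
    (∀ ω₂ lam β γ : ℝ, 0 < ω₂ → 0 < lam → 0 < β → 0 < γ → (∃ T₁ : ℝ, ∀ T : ℝ, T₁ < T → ∃ k : ℝ, 0 < k ∧ ∀ μ : (N : ℕ) → ℝ → ℝ → MeasureTheory.Measure (Literature.MathematicalPhysics.KineticTheory.HeatConduction.PhaseSpace N), (∀ (N : ℕ) (T_L T_R : ℝ), 0 < T_L → 0 < T_R → (Literature.MathematicalPhysics.KineticTheory.HeatConduction.pinnedChain ω₂ lam β γ).IsSteadyState N T_L T_R (μ N T_L T_R)) → ∃ D : ℕ → ℝ, (∀ N : ℕ, Filter.Tendsto (fun δ : ℝ => (Literature.MathematicalPhysics.KineticTheory.HeatConduction.pinnedChain ω₂ lam β γ).totalCurrent (μ N (T + δ / 2) (T - δ / 2)) / δ) (nhdsWithin 0 {(0 : ℝ)}ᶜ) (nhds (D N))) ∧ Filter.Tendsto D Filter.atTop (nhds k)) → ∀ a : ℝ, 0 < a → (∀ T : ℝ, 0 < T → T < a → ∃ k : ℝ, 0 < k ∧ ∀ μ : (N : ℕ) → ℝ → ℝ → MeasureTheory.Measure (Literature.MathematicalPhysics.KineticTheory.HeatConduction.PhaseSpace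 N), (∀ (N : ℕ) (T_L T_R : ℝ), 0 < T_L → 0 < T_R → (Literature.MathematicalPhysics.KineticTheory.HeatConduction.pinnedChain ω₂ lam β γ).IsSteadyState N T_L T_R (μ N T_L T_R)) → ∃ D : ℕ → ℝ, (∀ N : ℕ, Filter.Tendsto (fun δ : ℝ => (Literature.MathematicalPhysics.KineticTheory.HeatConduction.pinnedChain ω₂ lam β γ).totalCurrent (μ N (T + δ / 2) (T - δ / 2)) / δ) (nhdsWithin 0 {(0 : ℝ)}ᶜ) (nhds (D N))) ∧ Filter.Tendsto D Filter.atTop (nhds k)) → ∃ k : ℝ, 0 < k ∧ ∀ μ : (N : ℕ) → ℝ → ℝ → MeasureTheory.Measure (Literature.MathematicalPhysics.KineticTheory.HeatConduction.PhaseSpace N), (∀ (N : ℕ) (T_L T_R : ℝ), 0 < T_L → 0 < T_R → (Literature.MathematicalPhysics.KineticTheory.HeatConduction.pinnedChain ω₂ lam β γ).IsSteadyState N T_L T_R (μ N T_L T_R)) → ∃ D : ℕ → ℝ, (∀ N : ℕ, Filter.Tendsto (fun δ : ℝ => (Literature.MathematicalPhysics.KineticTheory.HeatConduction.pinnedChain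 ω₂ lam β γ).totalCurrent (μ N (a + δ / 2) (a - δ / 2)) / δ) (nhdsWithin 0 {(0 : ℝ)}ᶜ) (nhds (D N))) ∧ Filter.Tendsto D Filter.atTop (nhds k)) →
    (∀ ω₂ lam β γ : ℝ, 0 < ω₂ → 0 < lam → 0 < β → 0 < γ → (∃ T₀ : ℝ, 0 < T₀ ∧ ∀ T : ℝ, 0 < T → T < T₀ → ∃ k : ℝ, 0 < k ∧ ∀ μ : (N : ℕ) → ℝ → ℝ → MeasureTheory.Measure (Literature.MathematicalPhysics.KineticTheory.HeatConduction.PhaseSpace N), (∀ (N : ℕ) (T_L T_R : ℝ), 0 < T_L → 0 < T_R → (Literature.MathematicalPhysics.KineticTheory.HeatConduction.pinnedChain ω₂ lam β γ).IsSteadyState N T_L T_R (μ N T_L T_R)) → ∃ D : ℕ → ℝ, (∀ N : ℕ, Filter.Tendsto (fun δ : ℝ => (Literature.MathematicalPhysics.KineticTheory.HeatConduction.pinnedChain ω₂ lam β γ).totalCurrent (μ N (T + δ / 2) (T - δ / 2)) / δ) (nhdsWithin 0 {(0 : ℝ)}ᶜ) (nhds (D N))) ∧ Filter.Tendsto D Filter.atTop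 (nhds k)) → (∃ T₁ : ℝ, ∀ T : ℝ, T₁ < T → ∃ k : ℝ, 0 < k ∧ ∀ μ : (N : ℕ) → ℝ → ℝ → MeasureTheory.Measure (Literature.MathematicalPhysics.KineticTheory.HeatConduction.PhaseSpace N), (∀ (N : ℕ) (T_L T_R : ℝ), 0 < T_L → 0 < T_R → (Literature.MathematicalPhysics.KineticTheory.HeatConduction.pinnedChain ω₂ lam β γ).IsSteadyState N T_L T_R (μ N T_L T_R)) → ∃ D : ℕ → ℝ, (∀ N : ℕ, Filter.Tendsto (fun δ : ℝ => (Literature.MathematicalPhysics.KineticTheory.HeatConduction.pinnedChain ω₂ lam β γ).totalCurrent (μ N (T + δ / 2) (T - δ / 2)) / δ) (nhdsWithin 0 {(0 : ℝ)}ᶜ) (nhds (D N))) ∧ Filter.Tendsto D Filter.atTop (nhds k)) → ∀ T : ℝ, 0 < T → ∃ k : ℝ, 0 < k ∧ ∀ μ : (N : ℕ) → ℝ → ℝ → MeasureTheory.Measure (Literature.MathematicalPhysics.KineticTheory.HeatConduction.PhaseSpace N), (∀ (N : ℕ) (T_L T_R : ℝ), 0 < T_L → 0 < T_R → (Literature.MathematicalPhysics.KineticTheory.HeatConduction.pinnedChain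 ω₂ lam β γ).IsSteadyState N T_L T_R (μ N T_L T_R)) → ∃ D : ℕ → ℝ, (∀ N : ℕ, Filter.Tendsto (fun δ : ℝ => (Literature.MathematicalPhysics.KineticTheory.HeatConduction.pinnedChain ω₂ lam β γ).totalCurrent (μ N (T + δ / 2) (T - δ / 2)) / δ) (nhdsWithin 0 {(0 : ℝ)}ᶜ) (nhds (D N))) ∧ Filter.Tendsto D Filter.atTop (nhds k)) := by
  intro hOpen hClosed ω₂ lam β γ hω hl hβ hγ hlow hhigh
  exact sweep_Ioi (hOpen ω₂ lam β γ hω hl hβ hγ) (hClosed ω₂ lam β γ hω hl hβ hγ hhigh) hlow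

/- The same implication stated AT THE _root_.Summit.AtomisticToContinuum.FouriersLaw.Theses.ResistanceOnset.BridgeClosure'S NAME (its type is literally
`stub₁-statement → stub₂-statement → ResistanceOnset.BridgeClosure`; sorry-free; a definitional
re-typing of `bridgeClosure_of_localStability_of_noLowestBreakdown`).  Kept as an `example` (not a
named theorem) so that exactly one theorem of the file concludes the crux by name. -/
example :
    (∀ ω₂ lam β γ : ℝ, 0 < ω₂ → 0 < lam → 0 < β → 0 < γ → ∀ T : ℝ, 0 < T → (∃ k : ℝ, 0 < k ∧ ∀ μ : (N : ℕ) → ℝ → ℝ → MeasureTheory.Measure (Literature.MathematicalPhysics.KineticTheory.HeatConduction.PhaseSpace N), (∀ (N : ℕ) (T_L T_R : ℝ), 0 < T_L → 0 < T_R → (Literature.MathematicalPhysics.KineticTheory.HeatConduction.pinnedChain ω₂ lam β γ).IsSteadyState N T_L T_R (μ N T_L T_R)) → ∃ D : ℕ → ℝ, (∀ N : ℕ, Filter.Tendsto (fun δ : ℝ => (Literature.MathematicalPhysics.KineticTheory.HeatConduction.pinnedChain ω₂ lam β γ).totalCurrent (μ N (T + δ / 2) (T - δ / 2)) / δ) (nhdsWithin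 0 {(0 : ℝ)}ᶜ) (nhds (D N))) ∧ Filter.Tendsto D Filter.atTop (nhds k)) → ∃ ε : ℝ, 0 < ε ∧ ∀ T' : ℝ, 0 < T' → T - ε < T' → T' < T + ε → ∃ k : ℝ, 0 < k ∧ ∀ μ : (N : ℕ) → ℝ → ℝ → MeasureTheory.Measure (Literature.MathematicalPhysics.KineticTheory.HeatConduction.PhaseSpace N), (∀ (N : ℕ) (T_L T_R : ℝ), 0 < T_L → 0 < T_R → (Literature.MathematicalPhysics.KineticTheory.HeatConduction.pinnedChain ω₂ lam β γ).IsSteadyState N T_L T_R (μ N T_L T_R)) → ∃ D : ℕ → ℝ, (∀ N : ℕ, Filter.Tendsto (fun δ : ℝ => (Literature.MathematicalPhysics.KineticTheory.HeatConduction.pinnedChain ω₂ lam β γ).totalCurrent (μ N (T' + δ / 2) (T' - δ / 2)) / δ) (nhdsWithin 0 {(0 : ℝ)}ᶜ) (nhds (D N))) ∧ Filter.Tendsto D Filter.atTop (nhds k)) →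
    (∀ ω₂ lam β γ : ℝ, 0 < ω₂ → 0 < lam → 0 < β → 0 < γ → (∃ T₁ : ℝ, ∀ T : ℝ, T₁ < T → ∃ k : ℝ, 0 < k ∧ ∀ μ : (N : ℕ) → ℝ → ℝ → MeasureTheory.Measure (Literature.MathematicalPhysics.KineticTheory.HeatConduction.PhaseSpace N), (∀ (N : ℕ) (T_L T_R : ℝ), 0 < T_L → 0 < T_R → (Literature.MathematicalPhysics.KineticTheory.HeatConduction.pinnedChain ω₂ lam β γ).IsSteadyState N T_L T_R (μ N T_L T_R)) → ∃ D : ℕ → ℝ, (∀ N : ℕ, Filter.Tendsto (fun δ : ℝ => (Literature.MathematicalPhysics.KineticTheory.HeatConduction.pinnedChain ω₂ lam β γ).totalCurrent (μ N (T + δ / 2) (T - δ / 2)) / δ) (nhdsWithin 0 {(0 : ℝ)}ᶜ) (nhds (D N))) ∧ Filter.Tendsto D Filter.atTop (nhds k)) → ∀ a : ℝ, 0 < a → (∀ T : ℝ, 0 < T → T < a → ∃ k : ℝ, 0 < k ∧ ∀ μ : (N : ℕ) → ℝ → ℝ → MeasureTheory.Measure (Literature.MathematicalPhysics.KineticTheory.HeatConduction.PhaseSpace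 N), (∀ (N : ℕ) (T_L T_R : ℝ), 0 < T_L → 0 < T_R → (Literature.MathematicalPhysics.KineticTheory.HeatConduction.pinnedChain ω₂ lam β γ).IsSteadyState N T_L T_R (μ N T_L T_R)) → ∃ D : ℕ → ℝ, (∀ N : ℕ, Filter.Tendsto (fun δ : ℝ => (Literature.MathematicalPhysics.KineticTheory.HeatConduction.pinnedChain ω₂ lam β γ).totalCurrent (μ N (T + δ / 2) (T - δ / 2)) / δ) (nhdsWithin 0 {(0 : ℝ)}ᶜ) (nhds (D N))) ∧ Filter.Tendsto D Filter.atTop (nhds k)) → ∃ k : ℝ, 0 < k ∧ ∀ μ : (N : ℕ) → ℝ → ℝ → MeasureTheory.Measure (Literature.MathematicalPhysics.KineticTheory.HeatConduction.PhaseSpace N), (∀ (N : ℕ) (T_L T_R : ℝ), 0 < T_L → 0 < T_R → (Literature.MathematicalPhysics.KineticTheory.HeatConduction.pinnedChain ω₂ lam β γ).IsSteadyState N T_L T_R (μ N T_L T_R)) → ∃ D : ℕ → ℝ, (∀ N : ℕ, Filter.Tendsto (fun δ : ℝ => (Literature.MathematicalPhysics.KineticTheory.HeatConduction.pinnedChain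 ω₂ lam β γ).totalCurrent (μ N (a + δ / 2) (a - δ / 2)) / δ) (nhdsWithin 0 {(0 : ℝ)}ᶜ) (nhds (D N))) ∧ Filter.Tendsto D Filter.atTop (nhds k)) →
    _root_.Summit.AtomisticToContinuum.FouriersLaw.Theses.ResistanceOnset.BridgeClosure :=
  bridgeClosure_of_localStability_of_noLowestBreakdown

/-- **Skeleton theorem — the crux `ResistanceOnset.BridgeClosure` BY NAME from the two registered stubs**
(the only theorem of this file concluding the crux; a proof-of-item that is NOT closed: its `sorry`s are
exactly those of `stub_localStability` and `stub_noLowestBreakdown`; the seam is the sorry-free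
`bridgeClosure_of_localStability_of_noLowestBreakdown` / `sweep_Ioi`). -/
theorem BridgeClosure_of : _root_.Summit.AtomisticToContinuum.FouriersLaw.Theses.ResistanceOnset.BridgeClosure :=
  bridgeClosure_of_localStability_of_noLowestBreakdown stub_localStability stub_noLowestBreakdown

end Birth

end Summit.AtomisticToContinuum.FouriersLaw.Cruxes.BridgeClosure
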